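import Mathlib.Algebra.Order.Chebyshev
import Literature.MathematicalPhysics.KineticTheory.HardSphereEulerProofs
import Literature.Analysis.FluidPDE.HardSphereDynamicsProofs
import HarnessLib

/-!
# Glue `MeanVarianceL2` of route `OneSphereInfluence`, part 3: the empirical fields as observables

Support file (`--supports stmt-AtomisticToContinuum-13622`) for the support item `MeanVarianceL2`
(`Summit.AtomisticToContinuum.HydrodynamicLimit.Theses.OneSphereInfluence.MeanVarianceL2`).
The three tested empirical fields (density, momentum coordinates, energy) as observables of a
hard-sphere configuration:

* measurability and the velocity-growth bounds `|F(w)| ≤ C_χ (1 + ∑ₖ |vₖ|²)` and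
  `F(w)² ≤ C_χ² (1 + (N+1)⁻¹ ∑ₖ |vₖ|⁴)`;
* transport along a hard-sphere flow: on the good set the kinetic energy is conserved
  (`IsHardSphereTrajectory.configEnergy_eq_holds`), so `w = Φ_t z` obeys the same bound in terms of
  the INITIAL velocities; the good set is conull for every local Gibbs law, and `Φ_0 = id` a.e.;
* the homogeneous (constant-profile) local Gibbs law: the average fourth velocity moment is the
  Gaussian one, `E[(N+1)⁻¹ ∑ₖ |vₖ|⁴] = ∫ |w|⁴ dN(ū, θ̄) < ∞` (disintegration
  `lintegral_localGibbsMeasure`, Fernique), which is the uniform-in-`N` second-moment bound of the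
  fields needed for uniform integrability at `κ = 0`.
-/

noncomputable section

open MeasureTheory ProbabilityTheory Filter Set Topology
open scoped ENNReal InnerProductSpace

namespace Summit.AtomisticToContinuum.HydrodynamicLimit.Theorems.OneSphereInfluenceMeanVarianceL2

open Literature.MathematicalPhysics.KineticTheory Literature.Analysis.FluidPDE
open Literature.Analysis.FunctionSpaces

/-! ## The good set, time zero and energy conservation under a local Gibbs law -/

section Flow

variable {σ : ℝ} {N : ℕ}

/-- The bad set of a hard-sphere flow is null for the local Gibbs law (`≪` Liouville). [folklore] -/
theorem localGibbsLaw_compl_good {a₀ θ₀ : T3 → ℝ} {u₀ : T3 → V3}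
    (Φ : HardSphereFlow (Torus.geometry (Fin 3)) (hsDiameter σ N) (N + 1)) :
    localGibbsLaw σ a₀ u₀ θ₀ N Φ Φ.goodᶜ = 0 := by
  unfold localGibbsLaw particleLaw
  exact withDensity_absolutelyContinuous _ _ Φ.measure_compl_good

/-- Almost every configuration is good for the local Gibbs law. [folklore] -/
theorem ae_mem_good_localGibbsLaw {a₀ θ₀ : T3 → ℝ} {u₀ : T3 → V3}
    (Φ : HardSphereFlow (Torus.geometry (Fin 3)) (hsDiameter σ N) (N + 1)) :
    ∀ᵐ z ∂(localGibbsLaw σ a₀ u₀ θ₀ N Φ), z ∈ Φ.good :=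
  localGibbsLaw_compl_good Φ

/-- An observable and its restriction to the good set agree a.e. for the local Gibbs law.
[folklore] -/
theorem indicator_good_ae_eq {a₀ θ₀ : T3 → ℝ} {u₀ : T3 → V3}
    (Φ : HardSphereFlow (Torus.geometry (Fin 3)) (hsDiameter σ N) (N + 1))
    (G : Config (N + 1) (Fin 3) T3 → ℝ) :
    (fun z => Φ.good.indicator G z) =ᵐ[localGibbsLaw σ a₀ u₀ θ₀ N Φ] G := by
  filter_upwards [ae_mem_good_localGibbsLaw Φ] with z hz
  exact Set.indicator_of_mem hz G

/-- At time `0` the flow is the identity a.e. for the local Gibbs law. [folklore] -/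
theorem comp_flow_zero_ae_eq {a₀ θ₀ : T3 → ℝ} {u₀ : T3 → V3}
    (Φ : HardSphereFlow (Torus.geometry (Fin 3)) (hsDiameter σ N) (N + 1))
    (G : Config (N + 1) (Fin 3) T3 → ℝ) :
    (fun z => G (Φ.flow 0 z)) =ᵐ[localGibbsLaw σ a₀ u₀ θ₀ N Φ] G := by
  filter_upwards [ae_mem_good_localGibbsLaw Φ] with z hz
  rw [Φ.flow_zero z hz]

/-- **Conservation of the kinetic weight** `∑ₖ |vₖ|²` along the flow on the good set. [folklore] -/
theorem sum_sq_norm_flow (Φ : HardSphereFlow (Torus.geometry (Fin 3)) (hsDiameter σ N) (N + 1))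
    {z : Config (N + 1) (Fin 3) T3} (hz : z ∈ Φ.good) (t : ℝ) :
    ∑ k, ‖((Φ.flow t z) k).2‖ ^ 2 = ∑ k, ‖(z k).2‖ ^ 2 := by
  have h := IsHardSphereTrajectory.configEnergy_eq_holds (Φ.isTrajectory z hz) t 0
  simp only [Φ.flow_zero z hz, configEnergy] at h
  have h2 : (2 : ℝ)⁻¹ ≠ 0 := by norm_num
  exact mul_left_cancel₀ h2 h

/-- An invariant law: if `(Φ_t)_* P = P` then `∫ G ∘ Φ_t dP = ∫ G dP`. [folklore] -/
theorem integral_comp_flow_of_lawAt_eq (Φ : HardSphereFlow (Torus.geometry (Fin 3)) (hsDiameter σ N) (N + 1))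
    {P : Measure (Config (N + 1) (Fin 3) T3)} {t : ℝ} (hinv : Φ.lawAt P t = P)
    {G : Config (N + 1) (Fin 3) T3 → ℝ} (hG : Measurable G) :
    ∫ z, G (Φ.flow t z) ∂P = ∫ z, G z ∂P := by
  have h := integral_map (μ := P) (Φ.measurable_flow t).aemeasurable hG.aestronglyMeasurable
  rw [← HardSphereFlow.lawAt_eq, hinv] at h
  exact h.symm

end Flow

/-! ## The empirical fields: measurability and velocity-growth bounds -/

section Fields

variable {N : ℕ}

/-- `|v| ≤ 1 + |v|²`. [folklore] -/
theorem norm_le_one_add_sq (v : V3) : ‖v‖ ≤ 1 + ‖v‖ ^ 2 := by nlinarith [norm_nonneg v, sq_nonneg (‖v‖ - 1)]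

/-- `|v|² ≤ 1 + |v|⁴`. [folklore] -/
theorem sq_le_one_add_pow_four (v : V3) : ‖v‖ ^ 2 ≤ 1 + ‖v‖ ^ 4 := by
  nlinarith [sq_nonneg (‖v‖ ^ 2 - 1), sq_nonneg ‖v‖]

/-- The density field is continuous in the configuration. [folklore] -/
theorem continuous_empiricalDensityField {χ : T3 → ℝ} (hχ : Continuous χ) :
    Continuous fun z : Config (N + 1) (Fin 3) T3 => empiricalDensityField z χ := by
  have h : (fun z : Config (N + 1) (Fin 3) T3 => empiricalDensityField z χ) =
      fun z => ((N + 1 : ℕ) : ℝ)⁻¹ * ∑ i, χ (z i).1 := funext fun z => empiricalDensityField_eq_sum z χ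
  rw [h]
  fun_prop

/-- A momentum coordinate field is continuous in the configuration. [folklore] -/
theorem continuous_empiricalMomentumField_apply {χ : T3 → ℝ} (hχ : Continuous χ) (j : Fin 3) :
    Continuous fun z : Config (N + 1) (Fin 3) T3 => empiricalMomentumField z χ j := by
  have h : (fun z : Config (N + 1) (Fin 3) T3 => empiricalMomentumField z χ j) =
      fun z => ((N + 1 : ℕ) : ℝ)⁻¹ * ∑ i, χ (z i).1 * (z i).2 j := by
    funext z
    rw [empiricalMomentumField_eq_sum]
    simp only [PiLp.smul_apply, WithLp.ofLp_sum, Finset.sum_apply, smul_eq_mul, WithLp.ofLp_smul,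
      Pi.smul_apply]
  rw [h]
  fun_prop

/-- The energy field is continuous in the configuration. [folklore] -/
theorem continuous_empiricalEnergyField {χ : T3 → ℝ} (hχ : Continuous χ) :
    Continuous fun z : Config (N + 1) (Fin 3) T3 => empiricalEnergyField z χ := by
  have h : (fun z : Config (N + 1) (Fin 3) T3 => empiricalEnergyField z χ) =
      fun z => ((N + 1 : ℕ) : ℝ)⁻¹ * ∑ i, χ (z i).1 * (‖(z i).2‖ ^ 2 / 2) :=
    funext fun z => empiricalEnergyField_eq_sum z χ
  rw [h]
  fun_prop

/-- A bounded-weight average is bounded: `|(N+1)⁻¹ ∑ᵢ χ(xᵢ) gᵢ| ≤ C (N+1)⁻¹ ∑ᵢ |gᵢ|`. [folklore] -/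
theorem abs_avg_mul_le {χ : T3 → ℝ} {C : ℝ} (hC : ∀ x, |χ x| ≤ C) (z : Config (N + 1) (Fin 3) T3)
    (g : Fin (N + 1) → ℝ) :
    |((N + 1 : ℕ) : ℝ)⁻¹ * ∑ i, χ (z i).1 * g i| ≤ C * (((N + 1 : ℕ) : ℝ)⁻¹ * ∑ i, |g i|) := by
  have hN : (0 : ℝ) < ((N + 1 : ℕ) : ℝ) := by positivity
  rw [abs_mul, abs_of_pos (inv_pos.2 hN), mul_left_comm]
  refine mul_le_mul_of_nonneg_left ?_ (inv_nonneg.2 hN.le)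
  calc |∑ i, χ (z i).1 * g i| ≤ ∑ i, |χ (z i).1 * g i| := Finset.abs_sum_le_sum_abs _ _
    _ ≤ ∑ i, C * |g i| := Finset.sum_le_sum fun i _ => by
        rw [abs_mul]; exact mul_le_mul_of_nonneg_right (hC _) (abs_nonneg _)
    _ = C * ∑ i, |g i| := by rw [Finset.mul_sum]

/-- The average of nonnegative terms is at most the sum. [folklore] -/
theorem avg_le_sum {g : Fin (N + 1) → ℝ} (hg : ∀ i, 0 ≤ g i) :
    ((N + 1 : ℕ) : ℝ)⁻¹ * ∑ i, g i ≤ ∑ i, g i := by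
  have hN : (1 : ℝ) ≤ ((N + 1 : ℕ) : ℝ) := by exact_mod_cast Nat.succ_pos N
  have hs : 0 ≤ ∑ i, g i := Finset.sum_nonneg fun i _ => hg i
  calc ((N + 1 : ℕ) : ℝ)⁻¹ * ∑ i, g i ≤ 1 * ∑ i, g i :=
        mul_le_mul_of_nonneg_right (inv_le_one_of_one_le₀ hN) hs
    _ = _ := one_mul _

/-- Square of a bounded-weight average: `((N+1)⁻¹ ∑ᵢ χ(xᵢ) gᵢ)² ≤ C² (N+1)⁻¹ ∑ᵢ gᵢ²`
(Cauchy–Schwarz). [folklore] -/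
theorem sq_avg_mul_le {χ : T3 → ℝ} {C : ℝ} (hC : ∀ x, |χ x| ≤ C) (z : Config (N + 1) (Fin 3) T3)
    (g : Fin (N + 1) → ℝ) :
    (((N + 1 : ℕ) : ℝ)⁻¹ * ∑ i, χ (z i).1 * g i) ^ 2 ≤ C ^ 2 * (((N + 1 : ℕ) : ℝ)⁻¹ * ∑ i, g i ^ 2) := by
  have hN : (0 : ℝ) < ((N + 1 : ℕ) : ℝ) := by positivity
  have hcs : (∑ i, χ (z i).1 * g i) ^ 2 ≤ ((N + 1 : ℕ) : ℝ) * ∑ i, (χ (z i).1 * g i) ^ 2 := by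
    have h := sq_sum_le_card_mul_sum_sq (s := Finset.univ) (f := fun i : Fin (N + 1) => χ (z i).1 * g i)
    simpa [Finset.card_univ, Fintype.card_fin] using h
  have hterm : ∀ i, (χ (z i).1 * g i) ^ 2 ≤ C ^ 2 * g i ^ 2 := fun i => by
    rw [mul_pow]
    refine mul_le_mul_of_nonneg_right ?_ (sq_nonneg _)
    rw [← sq_abs]
    exact pow_le_pow_left₀ (abs_nonneg _) (hC _) 2
  have hsum : ∑ i, (χ (z i).1 * g i) ^ 2 ≤ C ^ 2 * ∑ i, g i ^ 2 := by
    rw [Finset.mul_sum]; exact Finset.sum_le_sum fun i _ => hterm i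
  rw [mul_pow, inv_pow]
  calc (((N + 1 : ℕ) : ℝ) ^ 2)⁻¹ * (∑ i, χ (z i).1 * g i) ^ 2
      ≤ (((N + 1 : ℕ) : ℝ) ^ 2)⁻¹ * (((N + 1 : ℕ) : ℝ) * (C ^ 2 * ∑ i, g i ^ 2)) :=
        mul_le_mul_of_nonneg_left (hcs.trans (mul_le_mul_of_nonneg_left hsum hN.le)) (by positivity)
    _ = C ^ 2 * (((N + 1 : ℕ) : ℝ)⁻¹ * ∑ i, g i ^ 2) := by
        field_simp

/-- **Velocity growth of the density field**: `|ρ_N(χ)(w)| ≤ C_χ (1 + ∑ₖ|vₖ|²)`. [folklore] -/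
theorem abs_empiricalDensityField_le {χ : T3 → ℝ} {C : ℝ} (hC0 : 0 ≤ C) (hC : ∀ x, |χ x| ≤ C)
    (w : Config (N + 1) (Fin 3) T3) :
    |empiricalDensityField w χ| ≤ C * (1 + ∑ k, ‖(w k).2‖ ^ 2) := by
  rw [empiricalDensityField_eq_sum]
  have h := abs_avg_mul_le hC w (fun _ => 1)
  simp only [mul_one, abs_one, Finset.sum_const, Finset.card_univ, Fintype.card_fin, nsmul_eq_mul] at h
  have hN : ((N + 1 : ℕ) : ℝ)⁻¹ * ((N + 1 : ℕ) : ℝ) = 1 := inv_mul_cancel₀ (by positivity)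
  rw [hN] at h
  calc _ ≤ C * 1 := h
    _ ≤ C * (1 + ∑ k, ‖(w k).2‖ ^ 2) :=
        mul_le_mul_of_nonneg_left (le_add_of_nonneg_right (Finset.sum_nonneg fun _ _ => sq_nonneg _)) hC0

/-- **Velocity growth of a momentum coordinate field**: `|m_N(χ)ⱼ(w)| ≤ C_χ (1 + ∑ₖ|vₖ|²)`.
[folklore] -/
theorem abs_empiricalMomentumField_apply_le {χ : T3 → ℝ} {C : ℝ} (hC0 : 0 ≤ C)
    (hC : ∀ x, |χ x| ≤ C) (w : Config (N + 1) (Fin 3) T3) (j : Fin 3) :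
    |empiricalMomentumField w χ j| ≤ C * (1 + ∑ k, ‖(w k).2‖ ^ 2) := by
  have hsum : empiricalMomentumField w χ j = ((N + 1 : ℕ) : ℝ)⁻¹ * ∑ i, χ (w i).1 * (w i).2 j := by
    rw [empiricalMomentumField_eq_sum]
    simp only [PiLp.smul_apply, WithLp.ofLp_sum, Finset.sum_apply, smul_eq_mul, WithLp.ofLp_smul,
      Pi.smul_apply]
  rw [hsum]
  refine (abs_avg_mul_le hC w fun i => (w i).2 j).trans (mul_le_mul_of_nonneg_left ?_ hC0)
  have hle : ∀ i, |(w i).2 j| ≤ 1 + ‖(w i).2‖ ^ 2 := fun i =>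
    ((Real.norm_eq_abs _).symm.le.trans (PiLp.norm_apply_le ((w i).2) j)).trans (norm_le_one_add_sq _)
  have hN : (0 : ℝ) < ((N + 1 : ℕ) : ℝ) := by positivity
  calc ((N + 1 : ℕ) : ℝ)⁻¹ * ∑ i, |(w i).2 j|
      ≤ ((N + 1 : ℕ) : ℝ)⁻¹ * ∑ i, (1 + ‖(w i).2‖ ^ 2) :=
        mul_le_mul_of_nonneg_left (Finset.sum_le_sum fun i _ => hle i) (inv_nonneg.2 hN.le)
    _ = 1 + ((N + 1 : ℕ) : ℝ)⁻¹ * ∑ i, ‖(w i).2‖ ^ 2 := by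
        rw [Finset.sum_add_distrib, Finset.sum_const, Finset.card_univ, Fintype.card_fin, nsmul_eq_mul,
          mul_one, mul_add, inv_mul_cancel₀ hN.ne']
    _ ≤ 1 + ∑ k, ‖(w k).2‖ ^ 2 := add_le_add le_rfl (avg_le_sum fun i => sq_nonneg _)

/-- **Velocity growth of the energy field**: `|e_N(χ)(w)| ≤ C_χ (1 + ∑ₖ|vₖ|²)`. [folklore] -/
theorem abs_empiricalEnergyField_le {χ : T3 → ℝ} {C : ℝ} (hC0 : 0 ≤ C) (hC : ∀ x, |χ x| ≤ C)
    (w : Config (N + 1) (Fin 3) T3) :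
    |empiricalEnergyField w χ| ≤ C * (1 + ∑ k, ‖(w k).2‖ ^ 2) := by
  rw [empiricalEnergyField_eq_sum]
  refine (abs_avg_mul_le hC w fun i => ‖(w i).2‖ ^ 2 / 2).trans (mul_le_mul_of_nonneg_left ?_ hC0)
  have hle : ∀ i, |‖(w i).2‖ ^ 2 / 2| ≤ ‖(w i).2‖ ^ 2 := fun i => by
    rw [abs_of_nonneg (by positivity)]; nlinarith [sq_nonneg ‖(w i).2‖]
  calc ((N + 1 : ℕ) : ℝ)⁻¹ * ∑ i, |‖(w i).2‖ ^ 2 / 2| ≤ ∑ i, |‖(w i).2‖ ^ 2 / 2| :=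
        avg_le_sum fun i => abs_nonneg _
    _ ≤ ∑ i, ‖(w i).2‖ ^ 2 := Finset.sum_le_sum fun i _ => hle i
    _ ≤ 1 + ∑ k, ‖(w k).2‖ ^ 2 := le_add_of_nonneg_left zero_le_one

/-- **Second-moment majorant of the density field**: `ρ_N(χ)(z)² ≤ C_χ² (1 + (N+1)⁻¹∑ₖ|vₖ|⁴)`.
[folklore] -/
theorem sq_empiricalDensityField_le {χ : T3 → ℝ} {C : ℝ} (hC : ∀ x, |χ x| ≤ C)
    (z : Config (N + 1) (Fin 3) T3) :
    (empiricalDensityField z χ) ^ 2 ≤ C ^ 2 * (1 + ((N + 1 : ℕ) : ℝ)⁻¹ * ∑ k, ‖(z k).2‖ ^ 4) := by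
  rw [empiricalDensityField_eq_sum]
  have h := sq_avg_mul_le hC z (fun _ => 1)
  simp only [mul_one, one_pow, Finset.sum_const, Finset.card_univ, Fintype.card_fin, nsmul_eq_mul] at h
  have hN : ((N + 1 : ℕ) : ℝ)⁻¹ * ((N + 1 : ℕ) : ℝ) = 1 := inv_mul_cancel₀ (by positivity)
  rw [hN, mul_one] at h
  have h4 : 0 ≤ ((N + 1 : ℕ) : ℝ)⁻¹ * ∑ k, ‖(z k).2‖ ^ 4 :=
    mul_nonneg (inv_nonneg.2 (by positivity)) (Finset.sum_nonneg fun _ _ => by positivity)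
  calc _ ≤ C ^ 2 := h
    _ = C ^ 2 * 1 := (mul_one _).symm
    _ ≤ C ^ 2 * (1 + ((N + 1 : ℕ) : ℝ)⁻¹ * ∑ k, ‖(z k).2‖ ^ 4) :=
        mul_le_mul_of_nonneg_left (le_add_of_nonneg_right h4) (sq_nonneg _)

/-- **Second-moment majorant of a momentum coordinate field**:
`m_N(χ)ⱼ(z)² ≤ C_χ² (1 + (N+1)⁻¹∑ₖ|vₖ|⁴)`. [folklore] -/
theorem sq_empiricalMomentumField_apply_le {χ : T3 → ℝ} {C : ℝ} (hC : ∀ x, |χ x| ≤ C)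
    (z : Config (N + 1) (Fin 3) T3) (j : Fin 3) :
    (empiricalMomentumField z χ j) ^ 2 ≤ C ^ 2 * (1 + ((N + 1 : ℕ) : ℝ)⁻¹ * ∑ k, ‖(z k).2‖ ^ 4) := by
  have hsum : empiricalMomentumField z χ j = ((N + 1 : ℕ) : ℝ)⁻¹ * ∑ i, χ (z i).1 * (z i).2 j := by
    rw [empiricalMomentumField_eq_sum]
    simp only [PiLp.smul_apply, WithLp.ofLp_sum, Finset.sum_apply, smul_eq_mul, WithLp.ofLp_smul,
      Pi.smul_apply]
  rw [hsum]
  refine (sq_avg_mul_le hC z fun i => (z i).2 j).trans (mul_le_mul_of_nonneg_left ?_ (sq_nonneg _))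
  have hle : ∀ i, ((z i).2 j) ^ 2 ≤ 1 + ‖(z i).2‖ ^ 4 := fun i => by
    have h1 : |(z i).2 j| ≤ ‖(z i).2‖ := (Real.norm_eq_abs _).symm.le.trans (PiLp.norm_apply_le _ j)
    have h2 : ((z i).2 j) ^ 2 ≤ ‖(z i).2‖ ^ 2 := by
      rw [← sq_abs]; exact pow_le_pow_left₀ (abs_nonneg _) h1 2
    exact h2.trans (sq_le_one_add_pow_four _)
  have hN : (0 : ℝ) < ((N + 1 : ℕ) : ℝ) := by positivity
  calc ((N + 1 : ℕ) : ℝ)⁻¹ * ∑ i, ((z i).2 j) ^ 2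
      ≤ ((N + 1 : ℕ) : ℝ)⁻¹ * ∑ i, (1 + ‖(z i).2‖ ^ 4) :=
        mul_le_mul_of_nonneg_left (Finset.sum_le_sum fun i _ => hle i) (inv_nonneg.2 hN.le)
    _ = 1 + ((N + 1 : ℕ) : ℝ)⁻¹ * ∑ i, ‖(z i).2‖ ^ 4 := by
        rw [Finset.sum_add_distrib, Finset.sum_const, Finset.card_univ, Fintype.card_fin, nsmul_eq_mul,
          mul_one, mul_add, inv_mul_cancel₀ hN.ne']

/-- **Second-moment majorant of the energy field**: `e_N(χ)(z)² ≤ C_χ² (1 + (N+1)⁻¹∑ₖ|vₖ|⁴)`.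
[folklore] -/
theorem sq_empiricalEnergyField_le {χ : T3 → ℝ} {C : ℝ} (hC : ∀ x, |χ x| ≤ C)
    (z : Config (N + 1) (Fin 3) T3) :
    (empiricalEnergyField z χ) ^ 2 ≤ C ^ 2 * (1 + ((N + 1 : ℕ) : ℝ)⁻¹ * ∑ k, ‖(z k).2‖ ^ 4) := by
  rw [empiricalEnergyField_eq_sum]
  refine (sq_avg_mul_le hC z fun i => ‖(z i).2‖ ^ 2 / 2).trans (mul_le_mul_of_nonneg_left ?_ (sq_nonneg _))
  have hle : ∀ i, (‖(z i).2‖ ^ 2 / 2) ^ 2 ≤ 1 + ‖(z i).2‖ ^ 4 := fun i => by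
    nlinarith [sq_nonneg (‖(z i).2‖ ^ 2)]
  have hN : (0 : ℝ) < ((N + 1 : ℕ) : ℝ) := by positivity
  calc ((N + 1 : ℕ) : ℝ)⁻¹ * ∑ i, (‖(z i).2‖ ^ 2 / 2) ^ 2
      ≤ ((N + 1 : ℕ) : ℝ)⁻¹ * ∑ i, (1 + ‖(z i).2‖ ^ 4) :=
        mul_le_mul_of_nonneg_left (Finset.sum_le_sum fun i _ => hle i) (inv_nonneg.2 hN.le)
    _ = 1 + ((N + 1 : ℕ) : ℝ)⁻¹ * ∑ i, ‖(z i).2‖ ^ 4 := by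
        rw [Finset.sum_add_distrib, Finset.sum_const, Finset.card_univ, Fintype.card_fin, nsmul_eq_mul,
          mul_one, mul_add, inv_mul_cancel₀ hN.ne']

end Fields

/-! ## The homogeneous local Gibbs law: the average fourth velocity moment -/

section Homogeneous

variable {σ : ℝ} {N : ℕ}

/-- **Disintegration of a velocity average under the homogeneous local Gibbs law**: for constant
profiles `(c, ū, θ̄)` (`c ≥ 0`, `θ̄ > 0`) and measurable `g ≥ 0`,
`∫ (N+1)⁻¹ ∑ₖ g(vₖ) dP_N = ∫ g dN(ū, θ̄)` once `P_N` is a probability measure. [folklore] -/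
theorem lintegral_avg_localGibbsLaw_const {c θc : ℝ} {uc : V3} (hc : 0 ≤ c) (hθc : 0 < θc)
    (Φ : HardSphereFlow (Torus.geometry (Fin 3)) (hsDiameter σ N) (N + 1))
    [IsProbabilityMeasure (localGibbsMeasure σ (fun _ => c) (fun _ => uc) (fun _ => θc) N)]
    {g : V3 → ℝ≥0∞} (hg : Measurable g) :
    ∫⁻ z, ((N + 1 : ℕ) : ℝ≥0∞)⁻¹ * ∑ k, g (z k).2
        ∂(localGibbsLaw σ (fun _ => c) (fun _ => uc) (fun _ => θc) N Φ) =
      ∫⁻ w, g w ∂(gaussMeasure uc θc) := by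
  have hGm : Measurable fun z : Config (N + 1) (Fin 3) T3 => ((N + 1 : ℕ) : ℝ≥0∞)⁻¹ * ∑ k, g (z k).2 :=
    measurable_const.mul (Finset.measurable_sum _ fun k _ => hg.comp (measurable_pi_apply k).snd)
  rw [localGibbsLaw_eq, lintegral_localGibbsMeasure continuous_const continuous_const continuous_const
    (fun _ => hc) (fun _ => hθc) σ N hGm]
  -- the inner velocity integral is the Gaussian moment, independently of the positions
  have hinner : ∀ x : Fin (N + 1) → T3,
      ∫⁻ v, ((N + 1 : ℕ) : ℝ≥0∞)⁻¹ * ∑ k, g ((zipConfig (x, v)) k).2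
        ∂velMeasure (fun _ => uc) (fun _ => θc) x = ∫⁻ w, g w ∂(gaussMeasure uc θc) := by
    intro x
    simp only [zipConfig_apply]
    have hvel : velMeasure (fun _ : T3 => uc) (fun _ => θc) x = Measure.pi fun _ : Fin (N + 1) =>
        gaussMeasure uc θc := rfl
    have hsm : Measurable fun v : Fin (N + 1) → V3 => ∑ k, g (v k) :=
      Finset.measurable_sum _ fun k _ => hg.comp (measurable_pi_apply k)
    have hkm : ∀ k ∈ (Finset.univ : Finset (Fin (N + 1))), Measurable fun v : Fin (N + 1) → V3 => g (v k) :=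
      fun k _ => hg.comp (measurable_pi_apply k)
    rw [hvel, lintegral_const_mul _ hsm, lintegral_finsetSum _ hkm]
    have hk : ∀ k : Fin (N + 1), ∫⁻ v : Fin (N + 1) → V3, g (v k)
        ∂(Measure.pi fun _ : Fin (N + 1) => gaussMeasure uc θc) = ∫⁻ w, g w ∂(gaussMeasure uc θc) :=
      fun k => (measurePreserving_eval (fun _ : Fin (N + 1) => gaussMeasure uc θc) k).lintegral_comp hg
    simp only [hk, Finset.sum_const, Finset.card_univ, Fintype.card_fin, nsmul_eq_mul]
    rw [← mul_assoc, ENNReal.inv_mul_cancel (by exact_mod_cast Nat.succ_ne_zero N)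
      (ENNReal.natCast_ne_top _), one_mul]
  simp_rw [hinner]
  have hρm : Measurable fun x : Fin (N + 1) → T3 => ENNReal.ofReal
      ((canonicalPartition (Torus.geometry (Fin 3)) (hsDiameter σ N) (N + 1)
        (localGibbsProfile (fun _ => c) (fun _ => uc) (fun _ => θc)))⁻¹ *
          posWeight (fun _ => c) (hsDiameter σ N) (N + 1) x) :=
    (measurable_const.mul (measurable_posWeight continuous_const _ _)).ennreal_ofReal
  rw [lintegral_mul_const _ hρm, lintegral_posWeight_eq_one continuous_const continuous_const
    continuous_const (fun _ => hc) (fun _ => hθc) σ N, one_mul]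

/-- The fourth moment of the isotropic Gaussian is finite (Fernique). [folklore] -/
theorem lintegral_norm_pow_four_gaussMeasure_lt_top (uc : V3) (θc : ℝ) :
    ∫⁻ w, ENNReal.ofReal (‖w‖ ^ 4) ∂(gaussMeasure uc θc) < ∞ := by
  have h := (IsGaussian.memLp_id (gaussMeasure uc θc) 4 (by norm_num)).integrable_norm_pow (by norm_num)
  have h' := h.hasFiniteIntegral
  rw [hasFiniteIntegral_iff_ofReal (ae_of_all _ fun w => by positivity)] at h'
  simpa using h'

/-- **Uniform fourth-moment bound under the homogeneous local Gibbs law**: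
`∫ (N+1)⁻¹ ∑ₖ |vₖ|⁴ dP_N = ∫ |w|⁴ dN(ū, θ̄)` (a constant independent of `N`). [folklore] -/
theorem lintegral_avg_pow_four_localGibbsLaw_const {c θc : ℝ} {uc : V3} (hc : 0 ≤ c) (hθc : 0 < θc)
    (Φ : HardSphereFlow (Torus.geometry (Fin 3)) (hsDiameter σ N) (N + 1))
    [IsProbabilityMeasure (localGibbsMeasure σ (fun _ => c) (fun _ => uc) (fun _ => θc) N)] :
    ∫⁻ z, ENNReal.ofReal (((N + 1 : ℕ) : ℝ)⁻¹ * ∑ k, ‖(z k).2‖ ^ 4)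
        ∂(localGibbsLaw σ (fun _ => c) (fun _ => uc) (fun _ => θc) N Φ) =
      ∫⁻ w, ENNReal.ofReal (‖w‖ ^ 4) ∂(gaussMeasure uc θc) := by
  rw [← lintegral_avg_localGibbsLaw_const hc hθc Φ (g := fun w => ENNReal.ofReal (‖w‖ ^ 4))
    (by fun_prop)]
  refine lintegral_congr fun z => ?_
  rw [ENNReal.ofReal_mul (inv_nonneg.2 (by positivity)), ENNReal.ofReal_inv_of_pos (by positivity),
    ENNReal.ofReal_natCast, ENNReal.ofReal_sum_of_nonneg fun k _ => by positivity]

end Homogeneous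

end Summit.AtomisticToContinuum.HydrodynamicLimit.Theorems.OneSphereInfluenceMeanVarianceL2

end
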